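import Literature.IUT.HodgeTheaters.PMBaseProp67AlgorithmSub
import HarnessLib

/-!
# [IUTchI] Proposition 6.7 — the functor `Θ±-bridge ↦ Θ-bridge` on isomorphisms: laws, UNCONDITIONAL
# (sub-DAG row P67-L06 follow-up; proof-only, 0 defs)

S. Mochizuki, *Inter-universal Teichmüller theory I*, kurims manuscript (May 2020), §6, Proposition 6.7
p. 167 l.22–23 ("we obtain a functorial algorithm for constructing a [well-defined, up to a unique
isomorphism!] `𝒟-Θ`-bridge"), Definition 6.4 (i) p. 162 l.41–67 (isomorphisms of `𝒟-Θ^±`-bridges, "There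
is an evident notion of composition"), Definition 4.6 (ii) p. 111 (morphisms of `𝒟-Θ`-bridges)
[claim: Mochizuki2012, status: disputed] (D-0012 claim key; series status DISPUTED — this file is
label bookkeeping over the §6 base kit and asserts nothing about any disputed step; no side is taken on
[IUTchIII] Cor 3.12).

abc-iut-w5-d228 (`PMBaseProp67AlgorithmSub.lean`) defined Prop 6.7's functor ON ISOMORPHISMS,
`DThetaPMBridge.thetaBridgeData_map M hl I : Hom (B₁.thetaBridgeData M hl) (B₂.thetaBridgeData M hl)`, with
index bijection `I.absStarEquiv : T₁^⋇ ⥲ T₂^⋇`, and proved "unique isomorphism" MODULO the label-rigidity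
law (GAP-LEDGER G-w4d056-1, since derived for kits of a §4 datum by abc-iut-L5-t3, `KitCoreBridge`).
This file records what holds WITHOUT any law (audit abc-iut-w4-d054 2026-08-26T01:12Z, INFO O1/O2):

* `Iso.absStarEquiv_eq_labelMatch` — for `l` odd BOTH canonical labellings `T^⋇ ⥲ 𝔽_l^⋇` (Def 6.4 (i))
  are bijections and an isomorphism of `𝒟-Θ^±`-bridges preserves labels, so the bijection `T₁^⋇ ⥲ T₂^⋇`
  it induces is FORCED: it is the label-matching bijection, whatever the isomorphism;
* `thetaBridgeData_map_eq_labelMatch` / `thetaBridgeData_map_eq` — hence the functor's value on an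
  isomorphism `I : B₁ ⥲ B₂` does not depend on `I` (it is `thetaBridgeDataHom … labelMatch …`) — "well-defined,
  up to a unique isomorphism" read on the functor itself, unconditionally;
* `labelMatch_self`, `labelMatch_trans`, `labelMatch_symm_apply` — the label-matching bijections form a
  (thin) groupoid: identity, composition, inverse;
* `thetaBridgeData_map_ι_self` (IDENTITY LAW: every automorphism of a `𝒟-Θ^±`-bridge is sent to the Hom
  with identity index bijection) and `thetaBridgeData_map_ι_trans` (COMPOSITION LAW: for ANY
  `f : B₁ ⥲ B₂`, `g : B₂ ⥲ B₃`, `h : B₁ ⥲ B₃` the index bijection of the image of `h` is the composite of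
  those of `f` and `g` — in particular for `h` over abc-iut-L5-t4's `Iso.compIndexEquiv f g`), at the
  level of index bijections, which determine a Def-4.6 (ii) morphism (abc-iut-w5-d228's `Hom.ext'`).

Structure-level composition of `DThetaPMBridge.Iso` / `DThetaBridgeData.Hom` is not typed in the tree
(only `Iso.compIndexEquiv`); the laws above are therefore the complete functoriality content available,
and they need no law on the kit.  Hypotheses sit in the declaration headers; no `Prop` fact.
-/

namespace Literature.IUT.HodgeTheaters

open CategoryTheory

universe u

namespace PMBaseKit

variable {l : ℕ} {K : PMBaseKit.{u} l} (M : K.MultKit)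

namespace DThetaPMBridge

/-! ### The label-matching bijections form a thin groupoid -/

/-- `labelMatch` is characterised by label preservation: ANY label-preserving bijection `T₁^⋇ ⥲ T₂^⋇`
is the label-matching one (both labellings are bijections onto `𝔽_l^⋇`, abc-iut-w4-d054's
`starLabel_bijective`). ([IUTchI] Def 6.4 (i) p.162) [claim: Mochizuki2012, status: disputed] -/
theorem eq_labelMatch_of_starLabel (hl : Odd l) {B₁ B₂ : K.DThetaPMBridge}
    (e : B₁.grpT.AbsStar ≃ B₂.grpT.AbsStar) (he : ∀ q, B₂.starLabel hl (e q) = B₁.starLabel hl q) :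
    e = labelMatch hl B₁ B₂ := by
  ext q : 1
  apply (B₂.starLabel_bijective hl).1
  rw [he, starLabel_labelMatch]

/-- Identity: the label-matching bijection of a bridge with itself is the identity.
([IUTchI] Def 6.4 (i) p.162) [claim: Mochizuki2012, status: disputed] -/
theorem labelMatch_self (hl : Odd l) (B : K.DThetaPMBridge) : labelMatch hl B B = Equiv.refl _ :=
  (eq_labelMatch_of_starLabel hl (Equiv.refl _) fun _ => rfl).symm

/-- Composition: label-matching bijections compose. ([IUTchI] Def 6.4 (i) p.162) [claim: Mochizuki2012, status: disputed] -/
theorem labelMatch_trans (hl : Odd l) (B₁ B₂ B₃ : K.DThetaPMBridge) :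
    (labelMatch hl B₁ B₂).trans (labelMatch hl B₂ B₃) = labelMatch hl B₁ B₃ :=
  eq_labelMatch_of_starLabel hl _ fun q => by
    rw [Equiv.trans_apply, starLabel_labelMatch, starLabel_labelMatch]

/-- Inverse: the inverse of the label-matching bijection is the label-matching bijection the other way.
([IUTchI] Def 6.4 (i) p.162) [claim: Mochizuki2012, status: disputed] -/
theorem labelMatch_symm (hl : Odd l) (B₁ B₂ : K.DThetaPMBridge) :
    (labelMatch hl B₁ B₂).symm = labelMatch hl B₂ B₁ :=
  eq_labelMatch_of_starLabel hl _ fun q => by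
    conv_rhs => rw [← (labelMatch hl B₁ B₂).apply_symm_apply q]
    rw [starLabel_labelMatch]

/-! ### The index bijection of the functor's value is forced -/

/-- **The bijection `T₁^⋇ ⥲ T₂^⋇` induced by an isomorphism of `𝒟-Θ^±`-bridges is the label-matching one**,
for EVERY isomorphism (Def 6.4 (i): the index map is an isomorphism of `𝔽_l^±`-groups, hence preserves
the canonical labels — abc-iut-w5-d228's `starLabel_absStarEquiv` — and label-preserving bijections are
unique for `l` odd).  No law on the kit is used. ([IUTchI] Def 6.4 (i) p.162) [claim: Mochizuki2012, status: disputed] -/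
theorem Iso.absStarEquiv_eq_labelMatch (hl : Odd l) {B₁ B₂ : K.DThetaPMBridge} (I : Iso B₁ B₂) :
    I.absStarEquiv = labelMatch hl B₁ B₂ :=
  eq_labelMatch_of_starLabel hl _ (I.starLabel_absStarEquiv hl)

/-- **Prop 6.7's functor on isomorphisms has a value independent of the isomorphism**: for every
`I : B₁ ⥲ B₂` the induced Def-4.6 (ii) morphism of the outputs is the label-matching one
(`thetaBridgeDataHom … labelMatch …`, abc-iut-w5-d228's existence witness) — "well-defined, up to a unique
isomorphism" seen on the functor, UNCONDITIONALLY (no label-rigidity law).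
([IUTchI] Prop 6.7 p.167) [claim: Mochizuki2012, status: disputed] -/
theorem thetaBridgeData_map_eq_labelMatch (hl : Odd l) {B₁ B₂ : K.DThetaPMBridge} (I : Iso B₁ B₂) :
    thetaBridgeData_map M hl I =
      thetaBridgeDataHom M hl B₁ B₂ (labelMatch hl B₁ B₂) (starLabel_labelMatch hl B₁ B₂) := by
  apply DThetaBridgeData.Hom.ext'
  change Equiv.ulift.trans (I.absStarEquiv.trans Equiv.ulift.symm) =
    Equiv.ulift.trans ((labelMatch hl B₁ B₂).trans Equiv.ulift.symm)
  rw [I.absStarEquiv_eq_labelMatch hl]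

/-- … hence two isomorphisms `I, I' : B₁ ⥲ B₂` of `𝒟-Θ^±`-bridges induce THE SAME morphism of outputs.
([IUTchI] Prop 6.7 p.167) [claim: Mochizuki2012, status: disputed] -/
theorem thetaBridgeData_map_eq (hl : Odd l) {B₁ B₂ : K.DThetaPMBridge} (I I' : Iso B₁ B₂) :
    thetaBridgeData_map M hl I = thetaBridgeData_map M hl I' := by
  rw [thetaBridgeData_map_eq_labelMatch, thetaBridgeData_map_eq_labelMatch]

/-- The index bijection of the functor's value, on representatives: `(map I).ι q = labelMatch q`.
([IUTchI] Prop 6.7 p.167) [claim: Mochizuki2012, status: disputed] -/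
theorem thetaBridgeData_map_ι_down (hl : Odd l) {B₁ B₂ : K.DThetaPMBridge} (I : Iso B₁ B₂)
    (q : ULift.{u} B₁.grpT.AbsStar) :
    ((thetaBridgeData_map M hl I).ι q).down = labelMatch hl B₁ B₂ q.down := by
  change I.absStarEquiv q.down = _
  rw [I.absStarEquiv_eq_labelMatch hl]

/-! ### Functor laws at the level of index bijections -/

/-- **IDENTITY LAW.**  Every isomorphism `I : B ⥲ B` of a `𝒟-Θ^±`-bridge with itself (in particular any
structure-level identity, whose index bijection is `Equiv.refl`) is sent by Prop 6.7's functor to the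
Def-4.6 (ii) ENDOmorphism of the output whose index bijection is the identity. ([IUTchI] Prop 6.7 p.167) [claim: Mochizuki2012, status: disputed] -/
theorem thetaBridgeData_map_ι_self (hl : Odd l) {B : K.DThetaPMBridge} (I : Iso B B)
    (q : ULift.{u} B.grpT.AbsStar) : (thetaBridgeData_map M hl I).ι q = q := by
  apply congrArg ULift.up
  change I.absStarEquiv q.down = q.down
  rw [I.absStarEquiv_eq_labelMatch hl, labelMatch_self, Equiv.refl_apply]

/-- **COMPOSITION LAW.**  For isomorphisms `f : B₁ ⥲ B₂`, `g : B₂ ⥲ B₃` and ANY `h : B₁ ⥲ B₃` (for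
instance one whose index bijection is abc-iut-L5-t4's composite `Iso.compIndexEquiv f g`), the index
bijection of the image of `h` is the composite of the index bijections of the images of `f` and `g`.
([IUTchI] Prop 6.7 p.167) [claim: Mochizuki2012, status: disputed] -/
theorem thetaBridgeData_map_ι_trans (hl : Odd l) {B₁ B₂ B₃ : K.DThetaPMBridge} (f : Iso B₁ B₂)
    (g : Iso B₂ B₃) (h : Iso B₁ B₃) (q : ULift.{u} B₁.grpT.AbsStar) :
    (thetaBridgeData_map M hl h).ι q =
      (thetaBridgeData_map M hl g).ι ((thetaBridgeData_map M hl f).ι q) := by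
  apply congrArg ULift.up
  change h.absStarEquiv q.down = g.absStarEquiv (f.absStarEquiv q.down)
  rw [h.absStarEquiv_eq_labelMatch hl, g.absStarEquiv_eq_labelMatch hl, f.absStarEquiv_eq_labelMatch hl,
    ← Equiv.trans_apply, labelMatch_trans]

/-- **INVERSE LAW.**  For isomorphisms `f : B₁ ⥲ B₂` and `g : B₂ ⥲ B₁` (for instance a structure-level
inverse of `f`), the index bijections of their images are mutually inverse.
([IUTchI] Prop 6.7 p.167) [claim: Mochizuki2012, status: disputed] -/
theorem thetaBridgeData_map_ι_symm (hl : Odd l) {B₁ B₂ : K.DThetaPMBridge} (f : Iso B₁ B₂)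
    (g : Iso B₂ B₁) (q : ULift.{u} B₁.grpT.AbsStar) :
    (thetaBridgeData_map M hl g).ι ((thetaBridgeData_map M hl f).ι q) = q := by
  apply congrArg ULift.up
  change g.absStarEquiv (f.absStarEquiv q.down) = q.down
  rw [g.absStarEquiv_eq_labelMatch hl, f.absStarEquiv_eq_labelMatch hl, ← labelMatch_symm hl B₁ B₂,
    Equiv.symm_apply_apply]

/-- The composite index bijection of abc-iut-L5-t4's `Iso.compIndexEquiv f g` induces, on nonzero
`{±1}`-classes, the composite of the induced bijections — consistent with the composition law.
([IUTchI] Def 6.4 (i) p.162) [claim: Mochizuki2012, status: disputed] -/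
theorem absEquiv_toAbs_compIndexEquiv {B₁ B₂ B₃ : K.DThetaPMBridge} (f : Iso B₁ B₂) (g : Iso B₂ B₃)
    (t : B₁.T) :
    B₃.grpT.toAbs (f.compIndexEquiv g t) = g.absEquiv (f.absEquiv (B₁.grpT.toAbs t)) := by
  rw [Iso.absEquiv_toAbs, Iso.absEquiv_toAbs]
  rfl

end DThetaPMBridge

end PMBaseKit

end Literature.IUT.HodgeTheaters
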